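import Mathlib
import Summits.KontsevichZagierPeriods.Zeta5Search.AperyDworkCongruenceAux

/-!
# AperyDworkCongruence — the Dwork-type boundary congruence `p³·b_{kp} ≡ b_k (mod p)` for Apéry's second solution (cell zeta5-irr)

HONEST FRAMING: systematic search; no irrationality claim unless certified. INSTRUMENT theorem of the ζ(5)
census cell zeta5-irr (HOME `run/shared/lean/pub/zeta5-irr/`; memo `zi-p2/LEMMAS.md` §B8-a «TOP-LAYER DIGIT LAW»
(zi-p2 g7, v0.7.2), optional Lean target **T-B8.2**; finding `zi-p2/FINDINGS-DENOM.md` §2.10). Nothing here is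
about ζ(5); no irrationality content; filing moves no rung. Filed by the cell's engine seat zi-eng (g3).

## Statement (zi-p2's (II), «the second-solution analogue of Gessel's `a_{pn} ≡ a_n`»)

For every odd prime `p` and every `k < p`:  `‖p³·b_{kp} − b_k‖_p < 1`, i.e. `p³ b_{kp} ≡ b_k (mod p)` in `ℤ_(p)`,
where `b_n = Σ_{j≤n} C(n,j)²C(n+j,j)² c_{n,j}`, `c_{n,j} = Σ_{m≤n} m⁻³ + Σ_{i=1}^{j} (−1)^{i−1}/(2i³C(n,i)C(n+i,i))`
is Apéry's second solution in explicit form (`AperyDwork.aperyB`; `b₁ = 6`, `b₂ = 351/4`).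
Theorem `padicNorm_p3_aperyB_block_sub_lt_one`.

## Proof (zi-p2's Kummer/Lucas bookkeeping, LEMMAS §B8-a v0.7.2, made kernel-exact)

Write `j = j₁p + j₀`. (A) If `j₀ ≠ 0` then `p ∣ C(kp,j)` (Lucas), so `‖C(kp,j)²C(kp+j,j)²‖ ≤ p⁻²`, while
`‖p³c_{kp,j}‖ ≤ p` (Aux, L1): the term is `< 1`. (B) If `j = j₁p`: when `k + j₁ ≥ p` both `C(kp+j₁p,j₁p)` and
`C(k+j₁,j₁)` are divisible by `p`, so `p³·(term at kp, j₁p)` and the term of `b_k` at `j₁` are each `< 1`; when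
`k + j₁ < p`, `C(kp,j₁p)²C((k+j₁)p,j₁p)² ≡ C(k,j₁)²C(k+j₁,j₁)² (mod p)` (Lucas) and
`‖p³c_{kp,j₁p} − c_{k,j₁}‖ < 1` (L2: the harmonic parts agree mod `p` — `p³·Σ_{m≤kp} m⁻³ ≡ Σ_{m≤k} m⁻³` — the inner
terms off the multiples of `p` have norm `≤ p⁻¹`, and at `i = (s+1)p` the unit denominators
`2(s+1)³C(kp,(s+1)p)C((k+s+1)p,(s+1)p) ≡ 2(s+1)³C(k,s+1)C(k+s+1,s+1)` agree mod `p`, `p` odd fixing the sign).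
Summing the blocks gives the claim. Not here: the ζ(2) analogue (zi-p2: an extra cancellation is needed — OBSERVED
only), the multi-digit law, and the identification of `aperyB` with the recurrence solution.
-/

namespace Summit.KontsevichZagierPeriods.Zeta5Search.AperyDwork

open Finset
open Literature.Combinatorics.Enumerative.AperyNumbers (aperyTerm)
open Literature.NumberTheory.Transcendental.Apery (H3)

section Main

variable {p : ℕ} [hp : Fact p.Prime]

omit hp in
/-- Splitting `range (k·q)` into `k` blocks of length `q`. -/
private theorem sum_range_mul_eq {M : Type*} [AddCommMonoid M] (f : ℕ → M) (q : ℕ) :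
    ∀ k : ℕ, ∑ x ∈ range (k * q), f x = ∑ i ∈ range k, ∑ j ∈ range q, f (i * q + j)
  | 0 => by simp
  | k + 1 => by
      rw [Finset.sum_range_succ (fun i => ∑ j ∈ range q, f (i * q + j)) k, ← sum_range_mul_eq f q k,
        add_mul, one_mul, Finset.sum_range_add]

/-- `p ∤ C(n,r)` for `r ≤ n < p`. -/
theorem not_dvd_choose_of_lt {n r : ℕ} (hn : n < p) (hr : r ≤ n) : ¬ p ∣ n.choose r := by
  intro h
  have h1 := one_le_padicValNat_of_dvd (Nat.choose_pos hr).ne' h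
  have h2 := padicValNat_choose_eq_zero (p := p) (i := r) hn
  omega

/-- Two natural numbers congruent mod `p`, one a `p`-unit: their reciprocals are congruent mod `p`. -/
theorem norm_inv_sub_inv_lt_one {E₁ E₂ : ℕ} (h : (E₁ : ZMod p) = (E₂ : ZMod p)) (h2 : ¬ p ∣ E₂) :
    padicNorm p (1 / (E₁ : ℚ) - 1 / (E₂ : ℚ)) < 1 := by
  have h1 : ¬ p ∣ E₁ := by
    intro hd
    apply h2
    rw [← ZMod.natCast_eq_zero_iff] at hd ⊢
    rw [← h, hd]
  have hE1 : (E₁ : ℚ) ≠ 0 := by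
    have : E₁ ≠ 0 := fun h0 => h1 (h0 ▸ dvd_zero p)
    exact_mod_cast this
  have hE2 : (E₂ : ℚ) ≠ 0 := by
    have : E₂ ≠ 0 := fun h0 => h2 (h0 ▸ dvd_zero p)
    exact_mod_cast this
  have e : 1 / (E₁ : ℚ) - 1 / (E₂ : ℚ) = (((E₂ : ℤ) - E₁ : ℤ) : ℚ) / ((E₁ : ℚ) * E₂) := by
    push_cast
    field_simp
  have hmod : E₁ ≡ E₂ [MOD p] := (ZMod.natCast_eq_natCast_iff _ _ _).mp h
  have hdvd : (p : ℤ) ∣ (E₂ : ℤ) - E₁ := (Nat.modEq_iff_dvd).mp hmod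
  rw [e, padicNorm.div, padicNorm.mul, (padicNorm.nat_eq_one_iff _).mpr h1,
    (padicNorm.nat_eq_one_iff _).mpr h2, mul_one, div_one]
  exact (padicNorm.int_lt_one_iff _).mpr hdvd

/-- **(B1)** Lucas on the outer binomials: `C(kp,j₁p)²C(kp+j₁p,j₁p)² ≡ C(k,j₁)²C(k+j₁,j₁)² (mod p)`. -/
theorem norm_aperyTerm_block_sub_lt_one (k j₁ : ℕ) :
    padicNorm p ((aperyTerm (k * p) (j₁ * p) : ℚ) - (aperyTerm k j₁ : ℚ)) < 1 := by
  have hz : ((aperyTerm (k * p) (j₁ * p) : ℕ) : ZMod p) = ((aperyTerm k j₁ : ℕ) : ZMod p) := by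
    unfold aperyTerm
    push_cast
    rw [cast_choose_mul_p, show k * p + j₁ * p = (k + j₁) * p by ring, cast_choose_mul_p]
  have hmod : aperyTerm (k * p) (j₁ * p) ≡ aperyTerm k j₁ [MOD p] :=
    (ZMod.natCast_eq_natCast_iff _ _ _).mp hz
  have hdvd : (p : ℤ) ∣ (aperyTerm k j₁ : ℤ) - (aperyTerm (k * p) (j₁ * p) : ℤ) :=
    (Nat.modEq_iff_dvd).mp hmod
  have h := (padicNorm.int_lt_one_iff _).mpr hdvd
  rw [← padicNorm.neg]
  push_cast at h ⊢
  rw [neg_sub]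
  exact h

/-- **(L2a)** The harmonic parts agree: `‖p³·H₃(kp) − H₃(k)‖_p < 1` (any `k`: the multiples of `p` in `[1, kp]`
contribute exactly `H₃(k)`, the rest has norm `≤ p⁻³`). -/
theorem norm_p3_H3_block_sub_lt_one (k : ℕ) :
    padicNorm p ((p : ℚ) ^ 3 * H3 (k * p) - H3 k) < 1 := by
  obtain ⟨q, hq⟩ : ∃ q, p = q + 1 := ⟨p - 1, (Nat.succ_pred_eq_of_pos hp.out.pos).symm⟩
  have hp0 : (p : ℚ) ≠ 0 := Nat.cast_ne_zero.mpr hp.out.ne_zero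
  have hsplit : ∀ g : ℕ → ℚ, ∑ r ∈ range p, g r = (∑ r ∈ range q, g r) + g q := by
    intro g; rw [hq, Finset.sum_range_succ]
  -- the block decomposition of `p³ H₃(kp) − H₃(k)`
  have hrepr : (p : ℚ) ^ 3 * H3 (k * p) - H3 k
      = ∑ s ∈ range k, ∑ r ∈ range q, (p : ℚ) ^ 3 / ((((s * p + r + 1) ^ 3 : ℕ)) : ℚ) := by
    unfold H3
    rw [sum_range_mul_eq (fun x => 1 / ((x : ℚ) + 1) ^ 3) p k, Finset.mul_sum]
    have hterm : ∀ s ∈ range k, (p : ℚ) ^ 3 * ∑ r ∈ range p, 1 / (((s * p + r : ℕ) : ℚ) + 1) ^ 3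
        = (∑ r ∈ range q, (p : ℚ) ^ 3 / ((((s * p + r + 1) ^ 3 : ℕ)) : ℚ)) + 1 / ((s : ℚ) + 1) ^ 3 := by
      intro s _
      rw [hsplit, mul_add, Finset.mul_sum]
      congr 1
      · refine Finset.sum_congr rfl fun r _ => ?_
        push_cast
        ring
      · have e : ((s * p + q : ℕ) : ℚ) + 1 = (p : ℚ) * ((s : ℚ) + 1) := by
          rw [hq]; push_cast; ring
        rw [e]
        field_simp
    rw [Finset.sum_congr rfl hterm, Finset.sum_add_distrib]
    ring
  rw [hrepr]
  apply padicNorm.sum_lt' _ zero_lt_one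
  intro s _
  apply padicNorm.sum_lt' _ zero_lt_one
  intro r hr
  simp only [mem_range] at hr
  apply norm_H3_term_lt_one (by positivity)
  intro hd
  have h1 : (s * p + r + 1) % p = r + 1 := by
    rw [add_assoc, Nat.mul_add_mod', Nat.mod_eq_of_lt (by omega)]
  have h2 : (s * p + r + 1) % p = 0 := Nat.mod_eq_zero_of_dvd hd
  omega

/-- **(L2)** `‖p³·c_{kp, j₁p} − c_{k, j₁}‖_p < 1` for `j₁ ≤ k`, `k + j₁ < p`, `p` odd. -/
theorem norm_p3_aperyC_block_sub_lt_one (hp2 : p ≠ 2) {k j₁ : ℕ} (hj : j₁ ≤ k) (hkj : k + j₁ < p) :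
    padicNorm p ((p : ℚ) ^ 3 * aperyC (k * p) (j₁ * p) - aperyC k j₁) < 1 := by
  have hk : k < p := by omega
  obtain ⟨q, hq⟩ : ∃ q, p = q + 1 := ⟨p - 1, (Nat.succ_pred_eq_of_pos hp.out.pos).symm⟩
  have hp0 : (p : ℚ) ≠ 0 := Nat.cast_ne_zero.mpr hp.out.ne_zero
  have hqe : Even q := by
    have hodd : Odd p := hp.out.odd_of_ne_two hp2
    have : p = q + 1 := hq
    rcases hodd with ⟨t, ht⟩
    exact ⟨t, by omega⟩
  have hsplit : ∀ g : ℕ → ℚ, ∑ r ∈ range p, g r = (∑ r ∈ range q, g r) + g q := by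
    intro g; rw [hq, Finset.sum_range_succ]
  have hpp : p ^ 2 = p * p := sq p
  have hkjp : (k + j₁ + 1) * p ≤ p * p := Nat.mul_le_mul_right p (by omega)
  have hkjp' : (k + j₁ + 1) * p = k * p + j₁ * p + p := by ring
  have hjkp : j₁ * p ≤ k * p := Nat.mul_le_mul_right p hj
  unfold aperyC
  have e : (p : ℚ) ^ 3 * (H3 (k * p) + ∑ i ∈ range (j₁ * p), (-1 : ℚ) ^ i / (aperyD (k * p) (i + 1) : ℚ))
      - (H3 k + ∑ i ∈ range j₁, (-1 : ℚ) ^ i / (aperyD k (i + 1) : ℚ))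
      = ((p : ℚ) ^ 3 * H3 (k * p) - H3 k)
        + ∑ s ∈ range j₁, ((p : ℚ) ^ 3 * ∑ r ∈ range p, (-1 : ℚ) ^ (s * p + r) / (aperyD (k * p) (s * p + r + 1) : ℚ)
            - (-1 : ℚ) ^ s / (aperyD k (s + 1) : ℚ)) := by
    rw [sum_range_mul_eq (fun i => (-1 : ℚ) ^ i / (aperyD (k * p) (i + 1) : ℚ)) p j₁,
      Finset.sum_sub_distrib, ← Finset.mul_sum]
    ring
  rw [e]
  refine lt_of_le_of_lt padicNorm.nonarchimedean (max_lt (norm_p3_H3_block_sub_lt_one k) ?_)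
  apply padicNorm.sum_lt' _ zero_lt_one
  intro s hs
  simp only [mem_range] at hs
  have hs1p : (s + 1) * p ≤ j₁ * p := Nat.mul_le_mul_right p (by omega)
  have hs1p' : (s + 1) * p = s * p + p := by ring
  rw [hsplit, mul_add, Finset.mul_sum, add_sub_assoc]
  refine lt_of_le_of_lt padicNorm.nonarchimedean (max_lt ?_ ?_)
  · -- inner terms off the multiples of `p`
    apply padicNorm.sum_lt' _ zero_lt_one
    intro r hr
    simp only [mem_range] at hr
    apply norm_term_kp_lt_one hp2 hk (by omega) (by omega) _ (by omega)
    intro hd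
    have h1 : (s * p + r + 1) % p = r + 1 := by
      rw [add_assoc, Nat.mul_add_mod', Nat.mod_eq_of_lt (by omega)]
    have h2 : (s * p + r + 1) % p = 0 := Nat.mod_eq_zero_of_dvd hd
    omega
  · -- the boundary term `i = (s+1)p` against the term `s+1` of `c_{k,j₁}`
    have hidx : s * p + q + 1 = (s + 1) * p := by rw [hq]; ring
    set E₁ : ℕ := 2 * (s + 1) ^ 3 * (k * p).choose ((s + 1) * p) * (k * p + (s + 1) * p).choose ((s + 1) * p)
      with hE₁
    have hD : (aperyD (k * p) ((s + 1) * p) : ℚ) = (p : ℚ) ^ 3 * (E₁ : ℚ) := by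
      simp only [aperyD, hE₁]
      push_cast
      ring
    have hE2nat : aperyD k (s + 1) = 2 * (s + 1) ^ 3 * k.choose (s + 1) * (k + (s + 1)).choose (s + 1) := rfl
    have hsign : (-1 : ℚ) ^ (s * p + q) = (-1) ^ s := by
      rw [show s * p + q = s + q * (s + 1) by rw [hq]; ring, pow_add, pow_mul, hqe.neg_one_pow, one_pow,
        mul_one]
    -- `E₂ = D(k, s+1)` is a `p`-unit and `E₁ ≡ E₂ (mod p)`
    have h2 : ((2 : ℕ) : ZMod p) ≠ 0 := by
      rw [Ne, ZMod.natCast_eq_zero_iff]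
      intro h
      exact hp2 ((Nat.prime_dvd_prime_iff_eq hp.out Nat.prime_two).mp h)
    have hs1 : ((s + 1 : ℕ) : ZMod p) ≠ 0 := by
      rw [Ne, ZMod.natCast_eq_zero_iff]
      intro h
      exact absurd (Nat.le_of_dvd (by omega) h) (by omega)
    have hc1 : ((k.choose (s + 1) : ℕ) : ZMod p) ≠ 0 := by
      rw [Ne, ZMod.natCast_eq_zero_iff]
      exact not_dvd_choose_of_lt hk (by omega)
    have hc2 : (((k + (s + 1)).choose (s + 1) : ℕ) : ZMod p) ≠ 0 := by
      rw [Ne, ZMod.natCast_eq_zero_iff]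
      exact not_dvd_choose_of_lt (by omega) (by omega)
    have hE2unit : ¬ p ∣ aperyD k (s + 1) := by
      rw [← ZMod.natCast_eq_zero_iff, hE2nat]
      push_cast
      have h2' : (2 : ZMod p) ≠ 0 := by exact_mod_cast h2
      have hs1' : ((s : ZMod p) + 1) ≠ 0 := by exact_mod_cast hs1
      exact mul_ne_zero (mul_ne_zero (mul_ne_zero h2' (pow_ne_zero 3 hs1')) hc1) hc2
    have hcong : (E₁ : ZMod p) = ((aperyD k (s + 1) : ℕ) : ZMod p) := by
      rw [hE₁, hE2nat]
      push_cast
      rw [cast_choose_mul_p, show k * p + (s + 1) * p = (k + (s + 1)) * p by ring, cast_choose_mul_p]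
    have hE1 : (E₁ : ℚ) ≠ 0 := by
      have : ¬ p ∣ E₁ := by
        rw [← ZMod.natCast_eq_zero_iff, hcong, ZMod.natCast_eq_zero_iff]; exact hE2unit
      have : E₁ ≠ 0 := fun h0 => this (h0 ▸ dvd_zero p)
      exact_mod_cast this
    have hE2 : (aperyD k (s + 1) : ℚ) ≠ 0 := by
      have : aperyD k (s + 1) ≠ 0 := fun h0 => hE2unit (h0 ▸ dvd_zero p)
      exact_mod_cast this
    have e2 : (p : ℚ) ^ 3 * ((-1 : ℚ) ^ (s * p + q) / (aperyD (k * p) (s * p + q + 1) : ℚ))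
        - (-1 : ℚ) ^ s / (aperyD k (s + 1) : ℚ)
        = (-1 : ℚ) ^ s * (1 / (E₁ : ℚ) - 1 / (aperyD k (s + 1) : ℚ)) := by
      rw [hidx, hD, hsign]
      field_simp
    rw [e2, padicNorm_neg_one_pow_mul]
    exact norm_inv_sub_inv_lt_one hcong hE2unit

/-- `‖C(n,j)²C(n+j,j)²‖_p ≤ p⁻²` as soon as `p ∣ C(n+j,j)`. -/
theorem norm_aperyTerm_le_of_dvd_right {n j : ℕ} (h : p ∣ (n + j).choose j) :
    padicNorm p (aperyTerm n j : ℚ) ≤ (p : ℚ) ^ (-2 : ℤ) := by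
  have hp0 : (p : ℚ) ≠ 0 := Nat.cast_ne_zero.mpr hp.out.ne_zero
  unfold aperyTerm
  push_cast
  rw [padicNorm.mul, pow_two, pow_two, padicNorm.mul, padicNorm.mul]
  have ha := padicNorm.of_nat (p := p) (n.choose j)
  have hb := padicNorm_natCast_le_inv_of_dvd h
  have ha0 := padicNorm.nonneg (p := p) (n.choose j : ℚ)
  have hb0 := padicNorm.nonneg (p := p) ((n + j).choose j : ℚ)
  have h1 : padicNorm p (n.choose j : ℚ) * padicNorm p (n.choose j : ℚ) ≤ 1 * 1 :=
    mul_le_mul ha ha ha0 zero_le_one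
  have h2 : padicNorm p ((n + j).choose j : ℚ) * padicNorm p ((n + j).choose j : ℚ)
      ≤ (p : ℚ) ^ (-1 : ℤ) * (p : ℚ) ^ (-1 : ℤ) := mul_le_mul hb hb hb0 (hb0.trans hb)
  calc padicNorm p (n.choose j : ℚ) * padicNorm p (n.choose j : ℚ)
        * (padicNorm p ((n + j).choose j : ℚ) * padicNorm p ((n + j).choose j : ℚ))
      ≤ 1 * 1 * ((p : ℚ) ^ (-1 : ℤ) * (p : ℚ) ^ (-1 : ℤ)) :=
        mul_le_mul h1 h2 (mul_nonneg hb0 hb0) (by norm_num)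
    _ = (p : ℚ) ^ (-2 : ℤ) := by rw [← zpow_add₀ hp0]; norm_num

/-- `‖C(n,j)²C(n+j,j)²‖_p ≤ p⁻²` as soon as `p ∣ C(n,j)`. -/
theorem norm_aperyTerm_le_of_dvd_left {n j : ℕ} (h : p ∣ n.choose j) :
    padicNorm p (aperyTerm n j : ℚ) ≤ (p : ℚ) ^ (-2 : ℤ) := by
  have hp0 : (p : ℚ) ≠ 0 := Nat.cast_ne_zero.mpr hp.out.ne_zero
  unfold aperyTerm
  push_cast
  rw [padicNorm.mul, pow_two, pow_two, padicNorm.mul, padicNorm.mul]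
  have ha := padicNorm_natCast_le_inv_of_dvd h
  have hb := padicNorm.of_nat (p := p) ((n + j).choose j)
  have ha0 := padicNorm.nonneg (p := p) (n.choose j : ℚ)
  have hb0 := padicNorm.nonneg (p := p) ((n + j).choose j : ℚ)
  have h1 : padicNorm p (n.choose j : ℚ) * padicNorm p (n.choose j : ℚ)
      ≤ (p : ℚ) ^ (-1 : ℤ) * (p : ℚ) ^ (-1 : ℤ) := mul_le_mul ha ha ha0 (ha0.trans ha)
  have h2 : padicNorm p ((n + j).choose j : ℚ) * padicNorm p ((n + j).choose j : ℚ) ≤ 1 * 1 :=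
    mul_le_mul hb hb hb0 zero_le_one
  calc padicNorm p (n.choose j : ℚ) * padicNorm p (n.choose j : ℚ)
        * (padicNorm p ((n + j).choose j : ℚ) * padicNorm p ((n + j).choose j : ℚ))
      ≤ (p : ℚ) ^ (-1 : ℤ) * (p : ℚ) ^ (-1 : ℤ) * (1 * 1) :=
        mul_le_mul h1 h2 (mul_nonneg hb0 hb0) (by positivity)
    _ = (p : ℚ) ^ (-2 : ℤ) := by rw [← zpow_add₀ hp0]; norm_num

/-- `p⁻² · p < 1`, the shape of all the term bounds. -/
theorem inv_sq_mul_lt_one {a b : ℚ} (hb0 : 0 ≤ b) (ha : a ≤ (p : ℚ) ^ (-2 : ℤ))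
    (hb : b ≤ p) : a * b < 1 := by
  have hp0 : (p : ℚ) ≠ 0 := Nat.cast_ne_zero.mpr hp.out.ne_zero
  have h1 : (1 : ℚ) < p := by exact_mod_cast hp.out.one_lt
  calc a * b ≤ (p : ℚ) ^ (-2 : ℤ) * p := mul_le_mul ha hb hb0 (by positivity)
    _ = (p : ℚ) ^ (-1 : ℤ) := by
        rw [show (p : ℚ) ^ (-2 : ℤ) * p = (p : ℚ) ^ (-2 : ℤ) * (p : ℚ) ^ (1 : ℤ) by rw [zpow_one],
          ← zpow_add₀ hp0]
        norm_num
    _ < 1 := (zpow_lt_one_iff_right₀ h1).mpr (by norm_num)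

/-- **(A)** Off the multiples of `p`: `‖p³ · C(kp,j)²C(kp+j,j)² · c_{kp,j}‖_p < 1` (`p ∤ j`, `j ≤ kp`, `k < p`). -/
theorem norm_blockTerm_lt_one_of_not_dvd (hp2 : p ≠ 2) {k j : ℕ} (hk : k < p) (hj : j ≤ k * p)
    (hpj : ¬ p ∣ j) :
    padicNorm p ((p : ℚ) ^ 3 * ((aperyTerm (k * p) j : ℚ) * aperyC (k * p) j)) < 1 := by
  rw [show (p : ℚ) ^ 3 * ((aperyTerm (k * p) j : ℚ) * aperyC (k * p) j)
      = (aperyTerm (k * p) j : ℚ) * ((p : ℚ) ^ 3 * aperyC (k * p) j) by ring, padicNorm.mul]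
  exact inv_sq_mul_lt_one (padicNorm.nonneg _)
    (norm_aperyTerm_le_of_dvd_left (dvd_choose_mul_p_of_not_dvd k j hpj))
    (norm_p3_aperyC_kp_le hp2 hk hj)

/-- **(B)** On the multiples of `p`: `‖p³ · (term of b_{kp} at j₁p) − (term of b_k at j₁)‖_p < 1` (`j₁ ≤ k < p`). -/
theorem norm_blockTerm_sub_lt_one (hp2 : p ≠ 2) {k j₁ : ℕ} (hk : k < p) (hj : j₁ ≤ k) :
    padicNorm p ((p : ℚ) ^ 3 * ((aperyTerm (k * p) (j₁ * p) : ℚ) * aperyC (k * p) (j₁ * p))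
      - (aperyTerm k j₁ : ℚ) * aperyC k j₁) < 1 := by
  have hjp : j₁ * p ≤ k * p := Nat.mul_le_mul_right p hj
  by_cases hkj : k + j₁ < p
  · rw [show (p : ℚ) ^ 3 * ((aperyTerm (k * p) (j₁ * p) : ℚ) * aperyC (k * p) (j₁ * p))
          - (aperyTerm k j₁ : ℚ) * aperyC k j₁
        = (aperyTerm (k * p) (j₁ * p) : ℚ) * ((p : ℚ) ^ 3 * aperyC (k * p) (j₁ * p) - aperyC k j₁)
          + ((aperyTerm (k * p) (j₁ * p) : ℚ) - (aperyTerm k j₁ : ℚ)) * aperyC k j₁ by ring]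
    refine lt_of_le_of_lt padicNorm.nonarchimedean (max_lt ?_ ?_)
    · rw [padicNorm.mul]
      exact lt_of_le_of_lt (mul_le_of_le_one_left (padicNorm.nonneg _) (padicNorm.of_nat _))
        (norm_p3_aperyC_block_sub_lt_one hp2 hj hkj)
    · rw [padicNorm.mul]
      exact mul_lt_one_of_nonneg_of_lt_one_left (padicNorm.nonneg _)
        (norm_aperyTerm_block_sub_lt_one k j₁) (norm_aperyC_small_le_one hp2 hk hj hkj)
  · push Not at hkj
    refine lt_of_le_of_lt padicNorm.sub (max_lt ?_ ?_)
    · rw [show (p : ℚ) ^ 3 * ((aperyTerm (k * p) (j₁ * p) : ℚ) * aperyC (k * p) (j₁ * p))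
          = (aperyTerm (k * p) (j₁ * p) : ℚ) * ((p : ℚ) ^ 3 * aperyC (k * p) (j₁ * p)) by ring,
        padicNorm.mul]
      exact inv_sq_mul_lt_one (padicNorm.nonneg _)
        (norm_aperyTerm_le_of_dvd_right (dvd_choose_block_of_ge hk (by omega) hkj))
        (norm_p3_aperyC_kp_le hp2 hk hjp)
    · rw [padicNorm.mul]
      exact inv_sq_mul_lt_one (padicNorm.nonneg _)
        (norm_aperyTerm_le_of_dvd_right (dvd_choose_add_of_ge hk (by omega) hkj))
        (norm_aperyC_small_le hp2 hk hj)

/-- **Dwork-type boundary congruence for Apéry's second solution** (zi-p2 T-B8.2): for every odd prime `p`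
and `k < p`, `‖p³·b_{kp} − b_k‖_p < 1`, i.e. `p³ b_{kp} ≡ b_k (mod p)`. -/
theorem padicNorm_p3_aperyB_block_sub_lt_one (hp2 : p ≠ 2) {k : ℕ} (hk : k < p) :
    padicNorm p ((p : ℚ) ^ 3 * aperyB (k * p) - aperyB k) < 1 := by
  obtain ⟨q, hq⟩ : ∃ q, p = q + 1 := ⟨p - 1, (Nat.succ_pred_eq_of_pos hp.out.pos).symm⟩
  have hsplit' : ∀ g : ℕ → ℚ, ∑ r ∈ range p, g r = g 0 + ∑ r ∈ range q, g (r + 1) := by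
    intro g; rw [hq, Finset.sum_range_succ', add_comm]
  have e : (p : ℚ) ^ 3 * aperyB (k * p) - aperyB k
      = (∑ j₁ ∈ range k, ((p : ℚ) ^ 3 * ∑ j₀ ∈ range p,
            (aperyTerm (k * p) (j₁ * p + j₀) : ℚ) * aperyC (k * p) (j₁ * p + j₀)
          - (aperyTerm k j₁ : ℚ) * aperyC k j₁))
        + ((p : ℚ) ^ 3 * ((aperyTerm (k * p) (k * p) : ℚ) * aperyC (k * p) (k * p))
          - (aperyTerm k k : ℚ) * aperyC k k) := by
    unfold aperyB
    rw [Finset.sum_range_succ, Finset.sum_range_succ,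
      sum_range_mul_eq (fun j => (aperyTerm (k * p) j : ℚ) * aperyC (k * p) j) p k,
      Finset.sum_sub_distrib, ← Finset.mul_sum]
    ring
  rw [e]
  refine lt_of_le_of_lt padicNorm.nonarchimedean (max_lt ?_ ?_)
  · apply padicNorm.sum_lt' _ zero_lt_one
    intro j₁ hj₁
    simp only [mem_range] at hj₁
    have hj1p : (j₁ + 1) * p ≤ k * p := Nat.mul_le_mul_right p (by omega)
    have hj1p' : (j₁ + 1) * p = j₁ * p + p := by ring
    rw [hsplit' (fun j₀ => (aperyTerm (k * p) (j₁ * p + j₀) : ℚ) * aperyC (k * p) (j₁ * p + j₀)),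
      add_zero, mul_add, Finset.mul_sum,
      show ∀ a b c : ℚ, a + b - c = (a - c) + b from fun a b c => by ring]
    refine lt_of_le_of_lt padicNorm.nonarchimedean (max_lt ?_ ?_)
    · exact norm_blockTerm_sub_lt_one hp2 hk hj₁.le
    · apply padicNorm.sum_lt' _ zero_lt_one
      intro r hr
      simp only [mem_range] at hr
      apply norm_blockTerm_lt_one_of_not_dvd hp2 hk (by omega)
      intro hd
      have h1 : (j₁ * p + (r + 1)) % p = r + 1 := by
        rw [Nat.mul_add_mod', Nat.mod_eq_of_lt (by omega)]
      have h2 : (j₁ * p + (r + 1)) % p = 0 := Nat.mod_eq_zero_of_dvd hd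
      omega
  · have := norm_blockTerm_sub_lt_one hp2 hk (le_refl k)
    simpa using this

end Main

end Summit.KontsevichZagierPeriods.Zeta5Search.AperyDwork
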